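import Literature.Topology.FourManifolds.ImmersionOrientation
import Summits.SmoothPoincare4.SmoothPoincare4.Theorems.SymplecticOrigamiOrigamiFoldExistenceStubPleatFreeStandardShadow

/-!
# Stub `stub_pleatFreeStandard` of line `shadow-pleats` for crux `OrigamiFoldExistence` — II: the seam
(item stmt-SmoothPoincare4-7844, route route-SmoothPoincare4-SymplecticOrigami; line lead seat 1)

Second of four files.  Setting: a `0`-pleat round-rim position, unbundled into the four
hypotheses actually used — `ι : M → ℝ⁵` a `C^∞` embedding (`Manifold.IsSmoothEmbedding`),
`0 < δ < 1`, the ROUND CLAUSE `range ι ∩ {h ≤ 1 - δ} = S⁴ ∩ {h ≤ 1 - δ}`, and injectivity of the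
differential of the shadow `proj5 ∘ ι` strictly above the plane `h = 1 - δ`.  Proved here:

* consequences of the round clause (both inclusions), smoothness/chain rule of the shadow,
  `dι` injective (immersion, tree `injective_mfderiv_of_isImmersionAt'`);
* `inner_mfderiv_eq_zero` — at a point of the CLOSURE of the round region `{h < 1 - δ}` every
  `dι v` is orthogonal to `ι m` (`‖ι‖² ≡ 1` on an open set accumulating at `m`; read in a chart,
  the derivative of a `C¹` map vanishes on that open set, hence at `m` by continuity) — this is
  the tangent-plane computation AT THE SEAM `h = 1 - δ`, where neither the hypothesis (open
  condition `h > 1 - δ`) nor the sphere (open condition `h < 1 - δ`) applies directly;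
  `mem_closure_of_apply_eq` puts seam points in that closure (meridian approximation of file I,
  transported by the embedding);
* `injective_mfderiv_shadow_of_pos` / `isLocalDiffeomorphAt_shadow_of_pos` — the shadow is a
  local diffeomorphism at EVERY point of positive height (inverse function theorem);
* the radius `ρ = √(1 - (1 - δ)²)` of the polar circle: norms of shadows on and below the seam,
  nonemptiness of the seam, `lt_height_of_norm_lt`.

Sources: Lee (2013) Thm 4.5, Prop 4.1 [LeeSmoothManifolds2013]; skeleton docstring of
`stub_pleatFreeStandard` (Cruxes/OrigamiFoldExistence/Lines/shadow_pleats.lean).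
-/

noncomputable section

-- the prescribed namespace `Summit.<P>.<Sub>.…` duplicates `SmoothPoincare4` (P = Sub)
set_option linter.dupNamespace false

open scoped Manifold ContDiff Topology RealInnerProductSpace
open Set Function Filter Metric ContinuousMap

namespace Summit.SmoothPoincare4.SmoothPoincare4.Theorems.OrigamiFoldExistence.ShadowPleats

/-! ### The setting: a `0`-pleat round-rim position -/

section RoundClause

variable {M : Type} {ι : M → EuclideanSpace ℝ (Fin 5)} {δ : ℝ}

/-- ROUND CLAUSE, `⊆`: a point of `M` of height `≤ 1 - δ` lies on the round sphere. -/
theorem mem_sphere_of_apply_le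
    (hround : Set.range ι ∩ {p : (EuclideanSpace ℝ (Fin 5)) | p 4 ≤ 1 - δ} = (Metric.sphere (0 : EuclideanSpace ℝ (Fin 5)) 1 : Set (EuclideanSpace ℝ (Fin 5))) ∩ {p : (EuclideanSpace ℝ (Fin 5)) | p 4 ≤ 1 - δ})
    {m : M} (hm : ι m 4 ≤ 1 - δ) : ι m ∈ (Metric.sphere (0 : EuclideanSpace ℝ (Fin 5)) 1) := by
  have : ι m ∈ Set.range ι ∩ {p : (EuclideanSpace ℝ (Fin 5)) | p 4 ≤ 1 - δ} := ⟨mem_range_self m, hm⟩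
  rw [hround] at this
  exact this.1

/-- ROUND CLAUSE, `⊇`: a point of the sphere of height `≤ 1 - δ` is in the image of `ι`. -/
theorem mem_range_of_mem_sphere
    (hround : Set.range ι ∩ {p : (EuclideanSpace ℝ (Fin 5)) | p 4 ≤ 1 - δ} = (Metric.sphere (0 : EuclideanSpace ℝ (Fin 5)) 1 : Set (EuclideanSpace ℝ (Fin 5))) ∩ {p : (EuclideanSpace ℝ (Fin 5)) | p 4 ≤ 1 - δ})
    {p : (EuclideanSpace ℝ (Fin 5))} (hp : p ∈ (Metric.sphere (0 : EuclideanSpace ℝ (Fin 5)) 1)) (h4 : p 4 ≤ 1 - δ) : p ∈ Set.range ι := by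
  have : p ∈ (Metric.sphere (0 : EuclideanSpace ℝ (Fin 5)) 1 : Set (EuclideanSpace ℝ (Fin 5))) ∩ {p : (EuclideanSpace ℝ (Fin 5)) | p 4 ≤ 1 - δ} := ⟨hp, h4⟩
  rw [← hround] at this
  exact this.1

end RoundClause

section ZeroPleat

variable {M : Type} [TopologicalSpace M] [ChartedSpace (EuclideanSpace ℝ (Fin 4)) M]
  {ι : M → EuclideanSpace ℝ (Fin 5)} {δ : ℝ}

/-- A smooth embedding has injective differential (immersion). -/
theorem injective_mfderiv_of_emb (hι : Manifold.IsSmoothEmbedding (𝓡 4) (𝓡 5) ∞ ι) (m : M) :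
    Injective (mfderiv (𝓡 4) (𝓡 5) ι m) :=
  Literature.Topology.FourManifolds.injective_mfderiv_of_isImmersionAt'
    (hι.isImmersion.isImmersionAt m)

/-- The shadow map `proj5 ∘ ι` is smooth. -/
theorem contMDiff_shadow (hι : Manifold.IsSmoothEmbedding (𝓡 4) (𝓡 5) ∞ ι) :
    ContMDiff (𝓡 4) (𝓡 4) ∞ (proj5 ∘ ι) := by
  rw [← coe_proj5L]
  exact proj5L.contDiff.contMDiff.comp hι.contMDiff

/-- Chain rule: the differential of the shadow map is `proj5L ∘ dι`. -/
theorem mfderiv_shadow (hι : Manifold.IsSmoothEmbedding (𝓡 4) (𝓡 5) ∞ ι) (m : M) :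
    mfderiv (𝓡 4) (𝓡 4) (proj5 ∘ ι) m = (proj5L : (EuclideanSpace ℝ (Fin 5)) →L[ℝ] (EuclideanSpace ℝ (Fin 4))).comp (mfderiv (𝓡 4) (𝓡 5) ι m) := by
  have hval : HasMFDerivAt (𝓡 4) (𝓡 5) ι m (mfderiv (𝓡 4) (𝓡 5) ι m) :=
    ((hι.contMDiff m).mdifferentiableAt (by simp)).hasMFDerivAt
  have hproj : HasMFDerivAt 𝓘(ℝ, (EuclideanSpace ℝ (Fin 5))) 𝓘(ℝ, (EuclideanSpace ℝ (Fin 4))) (proj5L : (EuclideanSpace ℝ (Fin 5)) → (EuclideanSpace ℝ (Fin 4))) (ι m) proj5L := proj5L.hasMFDerivAt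
  have hcomp := hproj.comp m hval
  rw [← coe_proj5L]
  exact hcomp.mfderiv

/-- The height function `m ↦ ι m 4` is continuous. -/
theorem continuous_height (hι : Manifold.IsSmoothEmbedding (𝓡 4) (𝓡 5) ∞ ι) :
    Continuous fun m => ι m 4 := by
  have : Continuous fun m => heightL (ι m) := heightL.continuous.comp hι.contMDiff.continuous
  simpa using this

/-- A point of height exactly `1 - δ` (the SEAM) is in the closure of the round region. -/
theorem mem_closure_of_apply_eq (hι : Manifold.IsSmoothEmbedding (𝓡 4) (𝓡 5) ∞ ι)
    (hround : Set.range ι ∩ {p : (EuclideanSpace ℝ (Fin 5)) | p 4 ≤ 1 - δ} = (Metric.sphere (0 : EuclideanSpace ℝ (Fin 5)) 1 : Set (EuclideanSpace ℝ (Fin 5))) ∩ {p : (EuclideanSpace ℝ (Fin 5)) | p 4 ≤ 1 - δ})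
    (hδ : 0 < δ) (hδ1 : δ < 1) {m : M} (hm : ι m 4 = 1 - δ) :
    m ∈ closure {m' : M | ι m' 4 < 1 - δ} := by
  have hsph : ι m ∈ (Metric.sphere (0 : EuclideanSpace ℝ (Fin 5)) 1) := mem_sphere_of_apply_le hround hm.le
  have hcl : ι m ∈ closure ((Metric.sphere (0 : EuclideanSpace ℝ (Fin 5)) 1 : Set (EuclideanSpace ℝ (Fin 5))) ∩ {q : (EuclideanSpace ℝ (Fin 5)) | q 4 < 1 - δ}) :=
    mem_closure_sphere_inter_lt hsph hm (by linarith) (by linarith)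
  rw [hι.isEmbedding.closure_eq_preimage_closure_image]
  refine closure_mono ?_ hcl
  rintro q ⟨hq, hq4⟩
  obtain ⟨m', rfl⟩ := mem_range_of_mem_sphere hround hq (le_of_lt hq4)
  exact ⟨m', hq4, rfl⟩

variable [IsManifold (𝓡 4) ∞ M]

/-- **The tangent space at a point of the closure of the round region is tangent to the sphere**:
for `m` in the closure of `O = ι⁻¹{h < 1 - δ}` (where `ι` lands in the unit sphere), every
`dι_m v` is orthogonal to `ι m`.  (`‖ι‖² ≡ 1` on the open set `O`, so the derivative of `‖ι‖²`,
read in a chart, vanishes on an open set accumulating at `m`, hence at `m` by continuity of the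
derivative of a `C¹` map.) [folklore] -/
theorem inner_mfderiv_eq_zero (hι : Manifold.IsSmoothEmbedding (𝓡 4) (𝓡 5) ∞ ι)
    (hround : Set.range ι ∩ {p : (EuclideanSpace ℝ (Fin 5)) | p 4 ≤ 1 - δ} = (Metric.sphere (0 : EuclideanSpace ℝ (Fin 5)) 1 : Set (EuclideanSpace ℝ (Fin 5))) ∩ {p : (EuclideanSpace ℝ (Fin 5)) | p 4 ≤ 1 - δ})
    {m : M} (hm : m ∈ closure {m' : M | ι m' 4 < 1 - δ}) (v : EuclideanSpace ℝ (Fin 4)) :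
    ⟪ι m, (mfderiv (𝓡 4) (𝓡 5) ι m :
      EuclideanSpace ℝ (Fin 4) →L[ℝ] EuclideanSpace ℝ (Fin 5)) v⟫ = 0 := by
  set O : Set M := {m' : M | ι m' 4 < 1 - δ} with hO
  have hOopen : IsOpen O := isOpen_lt (continuous_height hι) continuous_const
  -- the squared norm `G = ‖ι‖²`
  set G : M → ℝ := fun m' => ‖ι m'‖ ^ 2 with hG
  have hGsmooth : ContMDiff (𝓡 4) 𝓘(ℝ, ℝ) ∞ G := (contDiff_norm_sq ℝ).contMDiff.comp hι.contMDiff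
  have hGO : ∀ m' ∈ O, G m' = 1 := fun m' hm' => by
    have h1 : ‖ι m'‖ = 1 := by simpa using mem_sphere_of_apply_le hround (le_of_lt hm')
    simp [hG, h1]
  -- read `G` in the chart at `m`
  set φ := extChartAt (𝓡 4) m with hφ
  set g : (EuclideanSpace ℝ (Fin 4)) → ℝ := G ∘ φ.symm with hg
  have htarget : IsOpen φ.target := isOpen_extChartAt_target m
  have hgsmooth : ContDiffOn ℝ ∞ g φ.target := by
    have h1 : ContMDiffOn 𝓘(ℝ, (EuclideanSpace ℝ (Fin 4))) 𝓘(ℝ, ℝ) ∞ g φ.target :=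
      hGsmooth.comp_contMDiffOn (contMDiffOn_extChartAt_symm m)
    exact h1.contDiffOn
  have hcont : ContinuousOn (fderiv ℝ g) φ.target :=
    hgsmooth.continuousOn_fderiv_of_isOpen htarget (by exact_mod_cast le_top)
  set O' : Set (EuclideanSpace ℝ (Fin 4)) := φ.target ∩ φ.symm ⁻¹' O with hO'
  have hO'open : IsOpen O' := (continuousOn_extChartAt_symm m).isOpen_inter_preimage htarget hOopen
  have hfd0 : ∀ x ∈ O', fderiv ℝ g x = 0 := fun x hx => by
    have hev : g =ᶠ[𝓝 x] fun _ => (1 : ℝ) :=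
      Filter.eventually_of_mem (hO'open.mem_nhds hx) fun y hy => hGO _ hy.2
    rw [hev.fderiv_eq]
    simp
  -- `φ m` lies in the closure of `O'`
  have hx0 : φ m ∈ closure O' := by
    have h1 : m ∈ closure (O ∩ φ.source) := by
      exact IsOpen.closure_inter (isOpen_extChartAt_source (I := 𝓡 4) m)
        (⟨hm, mem_extChartAt_source m⟩ : m ∈ closure O ∩ φ.source)
    have h2 : ContinuousWithinAt φ (O ∩ φ.source) m :=
      (continuousAt_extChartAt m).continuousWithinAt
    have h3 := h2.mem_closure_image h1
    refine closure_mono ?_ h3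
    rintro _ ⟨m', ⟨hm'O, hm's⟩, rfl⟩
    exact ⟨φ.map_source hm's, by simpa [φ.left_inv hm's] using hm'O⟩
  -- continuity of the derivative forces `fderiv g (φ m) = 0`
  have hzero : fderiv ℝ g (φ m) = 0 := by
    haveI : (𝓝[O'] (φ m)).NeBot := mem_closure_iff_nhdsWithin_neBot.1 hx0
    have hcw : ContinuousWithinAt (fderiv ℝ g) O' (φ m) :=
      (hcont _ (mem_extChartAt_target m)).mono inter_subset_left
    have hev : (fun _ => (0 : (EuclideanSpace ℝ (Fin 4)) →L[ℝ] ℝ)) =ᶠ[𝓝[O'] (φ m)] fderiv ℝ g :=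
      (eventually_mem_nhdsWithin.mono fun x hx => (hfd0 x hx).symm)
    exact tendsto_nhds_unique hcw (tendsto_const_nhds.congr' hev)
  -- relate to `mfderiv G m`
  have hGdiff : MDifferentiableAt (𝓡 4) 𝓘(ℝ, ℝ) G m := (hGsmooth m).mdifferentiableAt (by simp)
  have hmf : mfderiv (𝓡 4) 𝓘(ℝ, ℝ) G m = fderiv ℝ g (φ m) := by
    rw [hGdiff.mfderiv]
    have hr : Set.range (𝓡 4) = Set.univ := by simp
    rw [hr, fderivWithin_univ]
    rfl
  -- chain rule: `dG_m v = 2 ⟪ι m, dι_m v⟫`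
  have hchain : mfderiv (𝓡 4) 𝓘(ℝ, ℝ) G m v =
      ⟪ι m, (mfderiv (𝓡 4) (𝓡 5) ι m : (EuclideanSpace ℝ (Fin 4)) →L[ℝ] (EuclideanSpace ℝ (Fin 5))) v⟫ +
        ⟪ι m, (mfderiv (𝓡 4) (𝓡 5) ι m : (EuclideanSpace ℝ (Fin 4)) →L[ℝ] (EuclideanSpace ℝ (Fin 5))) v⟫ := by
    have h1 : HasMFDerivAt (𝓡 4) (𝓡 5) ι m (mfderiv (𝓡 4) (𝓡 5) ι m) :=
      ((hι.contMDiff m).mdifferentiableAt (by simp)).hasMFDerivAt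
    have h2 : HasMFDerivAt 𝓘(ℝ, (EuclideanSpace ℝ (Fin 5))) 𝓘(ℝ, ℝ) (fun q : (EuclideanSpace ℝ (Fin 5)) => ‖q‖ ^ 2) (ι m)
        (innerSL ℝ (ι m) + innerSL ℝ (ι m)) := by
      have h := (hasStrictFDerivAt_norm_sq (ι m)).hasFDerivAt
      rw [two_smul] at h
      exact h.hasMFDerivAt
    have h3 := (h2.comp m h1).mfderiv
    have hGdef : G = (fun q : (EuclideanSpace ℝ (Fin 5)) => ‖q‖ ^ 2) ∘ ι := rfl
    rw [hGdef, h3]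
    rfl
  have h0 : mfderiv (𝓡 4) 𝓘(ℝ, ℝ) G m v = 0 := by
    rw [hmf, hzero]
    rfl
  rw [hchain] at h0
  have key : ∀ X : ℝ, X + X = 0 → X = 0 := fun X hX => by linarith
  exact key _ h0

/-- **The shadow is immersive at every point of positive height** (hypothesis above the plane;
sphere geometry on and below the seam). -/
theorem injective_mfderiv_shadow_of_pos (hι : Manifold.IsSmoothEmbedding (𝓡 4) (𝓡 5) ∞ ι)
    (hδ : 0 < δ) (hδ1 : δ < 1)
    (hround : Set.range ι ∩ {p : (EuclideanSpace ℝ (Fin 5)) | p 4 ≤ 1 - δ} = (Metric.sphere (0 : EuclideanSpace ℝ (Fin 5)) 1 : Set (EuclideanSpace ℝ (Fin 5))) ∩ {p : (EuclideanSpace ℝ (Fin 5)) | p 4 ≤ 1 - δ})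
    (hinj : ∀ m : M, 1 - δ < ι m 4 → Injective (mfderiv (𝓡 4) (𝓡 4) (proj5 ∘ ι) m))
    {m : M} (hpos : 0 < ι m 4) : Injective (mfderiv (𝓡 4) (𝓡 4) (proj5 ∘ ι) m) := by
  by_cases hgt : 1 - δ < ι m 4
  · exact hinj m hgt
  have hcl : m ∈ closure {m' : M | ι m' 4 < 1 - δ} := by
    rcases (not_lt.1 hgt).lt_or_eq with hlt | heq
    · exact subset_closure hlt
    · exact mem_closure_of_apply_eq hι hround hδ hδ1 heq
  rw [mfderiv_shadow hι m]
  intro v₁ v₂ h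
  apply injective_mfderiv_of_emb hι m
  set w₁ : (EuclideanSpace ℝ (Fin 5)) := mfderiv (𝓡 4) (𝓡 5) ι m v₁ with hw₁
  set w₂ : (EuclideanSpace ℝ (Fin 5)) := mfderiv (𝓡 4) (𝓡 5) ι m v₂ with hw₂
  have e₁ : ⟪ι m, w₁⟫ = 0 := inner_mfderiv_eq_zero hι hround hcl v₁
  have e₂ : ⟪ι m, w₂⟫ = 0 := inner_mfderiv_eq_zero hι hround hcl v₂
  have horth : ⟪ι m, w₁ - w₂⟫ = 0 := by
    rw [inner_sub_right, e₁, e₂, sub_zero]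
  have hshadow : proj5 (w₁ - w₂) = 0 := by
    have h' : proj5L w₁ = proj5L w₂ := h
    rw [← proj5L_apply, map_sub, h', sub_self]
  exact sub_eq_zero.1 (eq_zero_of_inner_eq_zero_of_proj5_eq_zero hpos.ne' horth hshadow)

/-- **The shadow is a local diffeomorphism at every point of positive height.** -/
theorem isLocalDiffeomorphAt_shadow_of_pos (hι : Manifold.IsSmoothEmbedding (𝓡 4) (𝓡 5) ∞ ι)
    (hδ : 0 < δ) (hδ1 : δ < 1)
    (hround : Set.range ι ∩ {p : EuclideanSpace ℝ (Fin 5) | p 4 ≤ 1 - δ} =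
      (Metric.sphere (0 : EuclideanSpace ℝ (Fin 5)) 1 : Set (EuclideanSpace ℝ (Fin 5))) ∩
        {p : EuclideanSpace ℝ (Fin 5) | p 4 ≤ 1 - δ})
    (hinj : ∀ m : M, 1 - δ < ι m 4 → Injective (mfderiv (𝓡 4) (𝓡 4) (proj5 ∘ ι) m))
    {m : M} (hpos : 0 < ι m 4) : IsLocalDiffeomorphAt (𝓡 4) (𝓡 4) ∞ (proj5 ∘ ι) m :=
  isLocalDiffeomorphAt_of_injective_mfderiv_four (contMDiff_shadow hι)
    (injective_mfderiv_shadow_of_pos hι hδ hδ1 hround hinj hpos)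
/-! ### The radius `ρ = √(1 - (1 - δ)²)` of the polar circle and the seam -/

omit [TopologicalSpace M] [ChartedSpace (EuclideanSpace ℝ (Fin 4)) M] [IsManifold (𝓡 4) ∞ M] in
/-- On the sphere, a point of height in `(0, 1 - δ]` has shadow of norm `≥ ρ`. -/
theorem rho_le_norm_shadow
    (hround : Set.range ι ∩ {p : (EuclideanSpace ℝ (Fin 5)) | p 4 ≤ 1 - δ} = (Metric.sphere (0 : EuclideanSpace ℝ (Fin 5)) 1 : Set (EuclideanSpace ℝ (Fin 5))) ∩ {p : (EuclideanSpace ℝ (Fin 5)) | p 4 ≤ 1 - δ})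
    {m : M} (h0 : 0 < ι m 4) (hle : ι m 4 ≤ 1 - δ) :
    Real.sqrt (1 - (1 - δ) ^ 2) ≤ ‖proj5 (ι m)‖ := by
  have hsq : ‖proj5 (ι m)‖ ^ 2 = 1 - (ι m 4) ^ 2 :=
    norm_proj5_sq_of_mem_sphere (mem_sphere_of_apply_le hround hle)
  have hle2 : (ι m 4) ^ 2 ≤ (1 - δ) ^ 2 := by nlinarith
  calc Real.sqrt (1 - (1 - δ) ^ 2) ≤ Real.sqrt (‖proj5 (ι m)‖ ^ 2) :=
        Real.sqrt_le_sqrt (by rw [hsq]; linarith)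
    _ = ‖proj5 (ι m)‖ := Real.sqrt_sq (norm_nonneg _)

omit [TopologicalSpace M] [ChartedSpace (EuclideanSpace ℝ (Fin 4)) M] [IsManifold (𝓡 4) ∞ M] in
/-- On the seam (height exactly `1 - δ`) the shadow has norm exactly `ρ`. -/
theorem norm_shadow_of_seam
    (hround : Set.range ι ∩ {p : (EuclideanSpace ℝ (Fin 5)) | p 4 ≤ 1 - δ} = (Metric.sphere (0 : EuclideanSpace ℝ (Fin 5)) 1 : Set (EuclideanSpace ℝ (Fin 5))) ∩ {p : (EuclideanSpace ℝ (Fin 5)) | p 4 ≤ 1 - δ})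
    {m : M} (hm : ι m 4 = 1 - δ) : ‖proj5 (ι m)‖ = Real.sqrt (1 - (1 - δ) ^ 2) := by
  have hsq : ‖proj5 (ι m)‖ ^ 2 = 1 - (ι m 4) ^ 2 :=
    norm_proj5_sq_of_mem_sphere (mem_sphere_of_apply_le hround hm.le)
  rw [hm] at hsq
  rw [← hsq, Real.sqrt_sq (norm_nonneg _)]

omit [TopologicalSpace M] [ChartedSpace (EuclideanSpace ℝ (Fin 4)) M] [IsManifold (𝓡 4) ∞ M] in
/-- The seam is nonempty: the point `(ρ e₀, 1 - δ)` of the sphere is in the image of `ι`. -/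
theorem exists_seam (hδ : 0 < δ) (hδ1 : δ < 1)
    (hround : Set.range ι ∩ {p : (EuclideanSpace ℝ (Fin 5)) | p 4 ≤ 1 - δ} = (Metric.sphere (0 : EuclideanSpace ℝ (Fin 5)) 1 : Set (EuclideanSpace ℝ (Fin 5))) ∩ {p : (EuclideanSpace ℝ (Fin 5)) | p 4 ≤ 1 - δ}) :
    ∃ m : M, ι m 4 = 1 - δ := by
  set ρ := Real.sqrt (1 - (1 - δ) ^ 2) with hρ
  have hρsq : ρ ^ 2 = 1 - (1 - δ) ^ 2 := Real.sq_sqrt (by nlinarith)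
  set u : (EuclideanSpace ℝ (Fin 4)) := EuclideanSpace.single (0 : Fin 4) (1 : ℝ) with hu
  have hu1 : ‖u‖ = 1 := by simp [hu]
  set p : (EuclideanSpace ℝ (Fin 5)) := embedL (ρ • u) + (1 - δ) • e4 with hp
  have hpS : p ∈ (Metric.sphere (0 : EuclideanSpace ℝ (Fin 5)) 1) := by
    have h1 : ‖p‖ ^ 2 = 1 := by
      rw [hp, norm_sq_embedL_add_smul, norm_smul, hu1, mul_one, Real.norm_eq_abs,
        abs_of_nonneg (Real.sqrt_nonneg _), hρsq]
      ring
    have h2 : ‖p‖ = 1 := by nlinarith [norm_nonneg p]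
    simpa using h2
  have hp4 : p 4 = 1 - δ := by simp [hp, embedL_apply]
  obtain ⟨m, hm⟩ := mem_range_of_mem_sphere hround hpS hp4.le
  exact ⟨m, by rw [hm, hp4]⟩

omit [TopologicalSpace M] [ChartedSpace (EuclideanSpace ℝ (Fin 4)) M] [IsManifold (𝓡 4) ∞ M] in
/-- A point on or above the plane whose shadow has norm `< ρ` is strictly above the plane. -/
theorem lt_height_of_norm_lt
    (hround : Set.range ι ∩ {p : (EuclideanSpace ℝ (Fin 5)) | p 4 ≤ 1 - δ} = (Metric.sphere (0 : EuclideanSpace ℝ (Fin 5)) 1 : Set (EuclideanSpace ℝ (Fin 5))) ∩ {p : (EuclideanSpace ℝ (Fin 5)) | p 4 ≤ 1 - δ})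
    {m : M} (hK : 1 - δ ≤ ι m 4) (hn : ‖proj5 (ι m)‖ < Real.sqrt (1 - (1 - δ) ^ 2)) :
    1 - δ < ι m 4 := by
  rcases hK.lt_or_eq with h | h
  · exact h
  · exact absurd (norm_shadow_of_seam hround h.symm) hn.ne
end ZeroPleat

end Summit.SmoothPoincare4.SmoothPoincare4.Theorems.OrigamiFoldExistence.ShadowPleats

end
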